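import Literature.Analysis.FluidPDE.PassiveVectorTensorSuperposition
import HarnessLib

/-!
# Weak passive solenoidal vectors with a constant viscosity tensor and a FORCING
# `f = g + Σⱼ ∂ⱼ Fⱼ ∈ L²_t L²_x + L²_t H⁻¹_x` (forced twin of `PassiveVectorTensor`)

Analysis/FluidPDE file: ONE new definition (`Torus.IsWeakTensorPassiveVectorForcedOn`), everything
else proved; no named facts.

The notion. `Torus.IsWeakTensorPassiveVectorForcedOn A T 𝔸 b g F w₀ w`: weak solutions on
`T^d × [0,T)` of
`∂ₜw + (b·∇)w + A (w·∇)b + ∇π = 𝓛_𝔸 w + g + Σⱼ ∂ⱼ(F j)`, `∇·w = 0`, `w(0) = w₀`,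
with Frisch's constant fourth-order eddy-viscosity tensor `𝔸` (`(𝓛_𝔸 w)_i = Σ 𝔸 i a j b ∂_a∂_b w_j`,
*Turbulence* (9.57)), a prescribed divergence-free carrier `b`, and a forcing split into an
`L²((0,T) × T^d)` part `g` and a divergence-form part `Σⱼ ∂ⱼ(F j)` with columns
`F j ∈ L²((0,T) × T^d; ℝ^d)` — i.e. a forcing in `L²(0,T; L²) + L²(0,T; H⁻¹)`, the right-hand sides
of the linear theory of viscous flow (the abstract linear evolution problem `u' + Au = f`,
`f ∈ L²(0,T; V')`, of Temam, *Infinite-dimensional dynamical systems*, Ch. II §3, (3.2)–(3.5),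
Thm. 3.1 — there attributed to Lions–Magenes and to Temam, *Navier–Stokes equations*, Ch. III §1;
`V' ⊇ L² + ∇·L²`). The structure is the
UNFORCED class `Torus.IsWeakTensorPassiveVectorOn` of `PassiveVectorTensor.lean` VERBATIM (same eight
bookkeeping fields: measurability of the space–time lifts, `w ∈ L^∞(0,T; L²)`, `b ∈ L¹(0,T; L²)`,
`|b||w| ∈ L¹`, `b(t)`, `w(t)` weakly divergence free for a.e. `t`; same test class: smooth
divergence-free space–time fields vanishing near `t = T`, which eliminates `π`) plus the measurability
and square integrability of `g` and of the `F j`, and the weak identity acquires the work of the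
forcing on the test field,
`∫₀ᵀ∫ (⟪w, ∂ₜΨ + (b·∇)Ψ + 𝓛_𝔸^*Ψ⟫ + A⟪b, (w·∇)Ψ⟫) + ∫₀ᵀ∫ (⟪g, Ψ⟫ − Σⱼ ⟪F j, ∂ⱼΨ⟫) + ∫⟪w₀, Ψ(0)⟫ = 0`
(`∫⟪Σⱼ∂ⱼF j, Ψ⟫ = −Σⱼ∫⟪F j, ∂ⱼΨ⟫`; the source-term convention of the scalar forced classes
`Torus.IsWeakScalarTransportForcedOn` / `…DiagForcedOn`).

Proved here:
* `isWeakTensorPassiveVectorForcedOn_zero_iff` — with `g = 0`, `F = 0` the notion IS the unforced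
  class (conservative extension: every result on `IsWeakTensorPassiveVectorOn` applies at zero forcing),
  `IsWeakTensorPassiveVectorOn.forced_zero`;
* the class API of `PassiveVectorTensorClass` for the forced class (joint measurability, `L^∞_t L²_x`
  in `eLpNorm` form, `w(t) ∈ L²` a.e., `w ∈ L¹_{t,x}`, `‖b‖‖w‖ ∈ L¹_{t,x}`, the forcing in
  `L²((0,T) × T^d)` in product-measure / `MemLp` form, integrability of the pairings with continuous
  fields and of the weak and forcing integrands against a space–time test field, the weak identity in
  product-measure form);
* LINEARITY of the forced weak formulation in `(g, F, w₀, w)`: `add`, `const_smul`, `neg`, `sub`,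
  and the mixed forms `add_unforced` / `sub_unforced` (forced ± unforced solution along the same
  carrier and tensor = forced solution with the same forcing from the sum / difference of the data —
  the difference field of a perturbation argument).

Consumer: the split of the K1L one-level stub `stub_oneLevelL_IW` (route
`SolenoidalFractalHomogenisation`, crux `LagrangianRenormalisationStepDesign`, cell `ad-ideate`,
tenure ruling D24-6): after Lagrangian conjugation by the flow of the coarse levels, the frame field
solves the CONSTANT-tensor cell problem with a forcing of relative form-size `‖G_t − 1‖`
(`stub_conjugateL`), whose work is decay-relative (`stub_distortedCellLawL`). The energy inequality
with the work term is the sequel file.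

## Mathlib / tree search

Tree (`lean search 'Forced'`, `rg IsWeak.*ForcedOn`): scalar forced classes
`PassiveScalarForced` (`IsWeakScalarTransportForcedOn`, source `s ∈ L¹`),
`PassiveScalarDiagForced` (+ restart / trace / Duhamel files), linearised Navier–Stokes with an `L²`
source along smooth fields (`TorusLinearisedNSForcedEnergy`, classical, clauses as hypotheses); NO
forced class for either weak passive-VECTOR notion and no divergence-form (`H⁻¹`) forcing anywhere
(2026-08-28). Reused: `PassiveVectorTensorClass` (pattern of every API lemma),
`PassiveVectorTensorSuperposition` (pattern of `add` / `const_smul`; `IsWeaklyDivFree.add_of_integrable`,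
`IsWeaklyDivFree.const_smul'`), `PassiveScalarProofs` (`volume_restrict_prod_eq`,
`exists_bound_of_continuous_uncurry`), `FlatTorusProofs` (`aestronglyMeasurable_uncurry_of_stLift_restrict`).

## References

* R. Temam, *Infinite-Dimensional Dynamical Systems in Mechanics and Physics*, 2nd ed. (Springer
  1997), Ch. II §3.1–3.2, (3.2)–(3.5), Thm. 3.1, Lemma 3.2 (the linear evolution problem
  `u' + Au = f` with `f ∈ L²(0,T; V')`, `u₀ ∈ H`; existence, uniqueness, energy equality; there
  attributed to Lions–Magenes and to R. Temam, *Navier–Stokes Equations*, Ch. III §1). [`Temam1997`]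
* R. Temam, *Navier–Stokes Equations. Theory and Numerical Analysis*, 3rd ed. (North-Holland 1984),
  Ch. III §1 (the original of the preceding item; divergence-free tests). [`Temam1984`]
* R. J. DiPerna, P.-L. Lions, *Ordinary differential equations, transport theory and Sobolev
  spaces*, Invent. Math. 98 (1989), §II.1, (12)–(14) (weak transport classes, bookkeeping).
  [`DiPernaLions1989`]
* U. Frisch, *Turbulence* (CUP 1995), §9.6.3 eq. (9.57) p. 233 (anisotropic eddy viscosity).
  [`Frisch1995Turbulence`]
* K. Yoshida, Y. Kaneda, Phys. Rev. E 63 (2000) 016308, §II eq. (4)–(5). [`YoshidaKaneda2000`]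
-/

noncomputable section

open MeasureTheory TopologicalSpace Set Function Filter Topology
open scoped ENNReal NNReal InnerProductSpace

namespace Literature.Analysis.FluidPDE

namespace Torus

variable {d : Type*} [Fintype d] [DecidableEq d]

/-! ## The notion -/

/-- Weak solutions on `[0,T)` of the FORCED passive-vector model with stretching coefficient `A`, a
CONSTANT FOURTH-ORDER VISCOSITY TENSOR `𝔸` and a prescribed divergence-free carrier `b`:
`∂ₜw + (b·∇)w + A (w·∇)b + ∇π = 𝓛_𝔸 w + g + Σⱼ ∂ⱼ(F j)`, `∇·w = 0`, `w(0) = w₀` on `T^d`,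
`(𝓛_𝔸 w)_i = Σ_{a,j,b} 𝔸 i a j b ∂_a ∂_b w_j` (Frisch's eddy-viscosity equation (9.57)), with a forcing
`f = g + Σⱼ ∂ⱼ(F j)`, `g ∈ L²((0,T) × T^d; ℝ^d)`, `F j ∈ L²((0,T) × T^d; ℝ^d)` the `j`-th column of the
flux — a right-hand side in `L²(0,T; L²) + L²(0,T; H⁻¹)` as in the linear theory of viscous flow
(Temam 1997, Ch. II §3: `u' + Au = f`, `f ∈ L²(0,T; V')`, (3.2)–(3.5)). VERBATIM the unforced class
`Torus.IsWeakTensorPassiveVectorOn A T 𝔸 b w₀ w` (its eight bookkeeping fields and its test class: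
smooth divergence-free space–time fields vanishing near `t = T`, which eliminates `π`) plus: `g` and the
`F j` are a.e. strongly measurable and square integrable on `(0,T) × T^d`, and the weak identity carries
the work of the forcing on the test field,
`∫₀ᵀ∫ (⟪w, ∂ₜΨ + (b·∇)Ψ + 𝓛_𝔸^*Ψ⟫ + A ⟪b, (w·∇)Ψ⟫) + ∫₀ᵀ∫ (⟪g, Ψ⟫ − Σⱼ ⟪F j, ∂ⱼΨ⟫) + ∫⟪w₀, Ψ(0)⟫ = 0`
(`∫⟪Σⱼ ∂ⱼF j, Ψ⟫ = −Σⱼ ∫⟪F j, ∂ⱼΨ⟫`). For `g = 0`, `F = 0` this IS the unforced class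
(`isWeakTensorPassiveVectorForcedOn_zero_iff`). No ellipticity of `𝔸` is built in.
[cite: Temam1997, Ch. II §3.1–3.2, (3.2)–(3.5), Thm. 3.1] [cite: Frisch1995Turbulence, §9.6.3 eq. (9.57) p. 233]
[cite: DiPernaLions1989, §II.1 (12)–(14)] -/
structure IsWeakTensorPassiveVectorForcedOn (A : ℝ) (T : ℝ) (𝔸 : Visc4 d)
    (b : ℝ → UnitAddTorus d → EuclideanSpace ℝ d) (g : ℝ → UnitAddTorus d → EuclideanSpace ℝ d)
    (F : d → ℝ → UnitAddTorus d → EuclideanSpace ℝ d) (w₀ : UnitAddTorus d → EuclideanSpace ℝ d)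
    (w : ℝ → UnitAddTorus d → EuclideanSpace ℝ d) : Prop where
  /-- `w` is a.e. strongly measurable on `(0,T) × T^d` (through the space–time lift). -/
  aestronglyMeasurable :
    AEStronglyMeasurable (FunctionSpaces.Torus.stLift w) (volume.restrict (Ioo 0 T ×ˢ univ))
  /-- `b` is a.e. strongly measurable on `(0,T) × T^d` (through the space–time lift). -/
  aestronglyMeasurable_carrier :
    AEStronglyMeasurable (FunctionSpaces.Torus.stLift b) (volume.restrict (Ioo 0 T ×ˢ univ))
  /-- `w ∈ L^∞(0,T; L²(T^d))`: `∫ ‖w(t)‖² ≤ C` for a.e. `t ∈ (0,T)`. -/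
  ae_lintegral_sq_le : ∃ C : ℝ≥0, ∀ᵐ t ∂(volume.restrict (Ioo 0 T)), ∫⁻ x, ‖w t x‖ₑ ^ 2 ≤ C
  /-- `b ∈ L¹(0,T; L²(T^d))`. -/
  lintegral_carrier_lt_top : ∫⁻ t in Ioo 0 T, (∫⁻ x, ‖b t x‖ₑ ^ 2) ^ (1 / 2 : ℝ) < ∞
  /-- `|b| |w| ∈ L¹((0,T) × T^d)` (so that both transport terms make sense). -/
  lintegral_mul_lt_top : ∫⁻ t in Ioo 0 T, ∫⁻ x, ‖b t x‖ₑ * ‖w t x‖ₑ < ∞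
  /-- `∇·b(t) = 0` weakly, for a.e. `t ∈ (0,T)`. -/
  ae_isWeaklyDivFree_carrier :
    ∀ᵐ t ∂(volume.restrict (Ioo 0 T)), FunctionSpaces.Torus.IsWeaklyDivFree (b t)
  /-- `∇·w(t) = 0` weakly, for a.e. `t ∈ (0,T)`. -/
  ae_isWeaklyDivFree :
    ∀ᵐ t ∂(volume.restrict (Ioo 0 T)), FunctionSpaces.Torus.IsWeaklyDivFree (w t)
  /-- `g` is a.e. strongly measurable on `(0,T) × T^d` (through the space–time lift). -/
  aestronglyMeasurable_force :
    AEStronglyMeasurable (FunctionSpaces.Torus.stLift g) (volume.restrict (Ioo 0 T ×ˢ univ))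
  /-- `g ∈ L²((0,T) × T^d)`. -/
  lintegral_force_sq_lt_top : ∫⁻ t in Ioo 0 T, ∫⁻ x, ‖g t x‖ₑ ^ 2 < ∞
  /-- Every column `F j` of the flux is a.e. strongly measurable on `(0,T) × T^d`. -/
  aestronglyMeasurable_flux : ∀ j,
    AEStronglyMeasurable (FunctionSpaces.Torus.stLift (F j)) (volume.restrict (Ioo 0 T ×ˢ univ))
  /-- Every column `F j` of the flux lies in `L²((0,T) × T^d)`. -/
  lintegral_flux_sq_lt_top : ∀ j, ∫⁻ t in Ioo 0 T, ∫⁻ x, ‖F j t x‖ₑ ^ 2 < ∞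
  /-- The weak formulation with datum and forcing, divergence-free vector tests:
  `∫₀ᵀ∫ (⟪w, ∂ₜΨ + (b·∇)Ψ + 𝓛_𝔸^*Ψ⟫ + A ⟪b, (w·∇)Ψ⟫) + ∫₀ᵀ∫ (⟪g, Ψ⟫ − Σⱼ ⟪F j, ∂ⱼΨ⟫) + ∫⟪w₀, Ψ(0)⟫ = 0`. -/
  weak_eq : ∀ Ψ : ℝ → UnitAddTorus d → EuclideanSpace ℝ d,
    FunctionSpaces.Torus.IsSpaceTimeTest T Ψ → (∀ t, FunctionSpaces.Torus.IsDivFree (Ψ t)) →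
    (∫ t in Ioo 0 T, ∫ x, (⟪w t x, FunctionSpaces.Torus.timeDeriv Ψ t x +
          FunctionSpaces.Torus.convect (b t) (Ψ t) x + viscAdj 𝔸 (Ψ t) x⟫_ℝ +
        A * ⟪b t x, FunctionSpaces.Torus.convect (w t) (Ψ t) x⟫_ℝ)) +
      (∫ t in Ioo 0 T, ∫ x, (⟪g t x, Ψ t x⟫_ℝ -
        ∑ j, ⟪F j t x, FunctionSpaces.Torus.partialDeriv j (Ψ t) x⟫_ℝ)) +
      ∫ x, ⟪w₀ x, Ψ 0 x⟫_ℝ = 0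

/-! ## Zero forcing: the unforced class -/

/-- **Conservative extension.** With `g = 0` and `F = 0` the forced notion IS the unforced class
`Torus.IsWeakTensorPassiveVectorOn A T 𝔸 b w₀ w`: the forcing fields hold trivially and the work term
vanishes identically. [cite: Temam1997, Ch. II §3.1–3.2, (3.2)–(3.5), Thm. 3.1] -/
theorem isWeakTensorPassiveVectorForcedOn_zero_iff {A T : ℝ} {𝔸 : Visc4 d}
    {b w : ℝ → UnitAddTorus d → EuclideanSpace ℝ d} {w₀ : UnitAddTorus d → EuclideanSpace ℝ d} :
    IsWeakTensorPassiveVectorForcedOn A T 𝔸 b (fun _ _ => 0) (fun _ _ _ => 0) w₀ w ↔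
      IsWeakTensorPassiveVectorOn A T 𝔸 b w₀ w := by
  have h0 : ∀ Ψ : ℝ → UnitAddTorus d → EuclideanSpace ℝ d,
      (∫ t in Ioo 0 T, ∫ x, (⟪(0 : EuclideanSpace ℝ d), Ψ t x⟫_ℝ -
        ∑ j, ⟪(0 : EuclideanSpace ℝ d), FunctionSpaces.Torus.partialDeriv j (Ψ t) x⟫_ℝ)) = 0 := by
    intro Ψ
    simp
  have hst : FunctionSpaces.Torus.stLift (fun (_ : ℝ) (_ : UnitAddTorus d) => (0 : EuclideanSpace ℝ d)) =
      fun _ => 0 := by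
    funext p; rfl
  constructor
  · rintro ⟨h1, h2, h3, h4, h5, h6, h7, -, -, -, -, h12⟩
    refine ⟨h1, h2, h3, h4, h5, h6, h7, fun Ψ hΨ hdiv => ?_⟩
    have e := h12 Ψ hΨ hdiv
    rw [h0 Ψ, add_zero] at e
    exact e
  · rintro ⟨h1, h2, h3, h4, h5, h6, h7, h8⟩
    refine ⟨h1, h2, h3, h4, h5, h6, h7, ?_, ?_, fun j => ?_, fun j => ?_, fun Ψ hΨ hdiv => ?_⟩
    · rw [hst]; exact aestronglyMeasurable_const
    · simp
    · rw [hst]; exact aestronglyMeasurable_const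
    · simp
    · rw [h0 Ψ, add_zero]
      exact h8 Ψ hΨ hdiv

/-- An unforced weak solution is a forced one with zero forcing.
[cite: Temam1997, Ch. II §3.1–3.2, (3.2)–(3.5), Thm. 3.1] -/
theorem IsWeakTensorPassiveVectorOn.forced_zero {A T : ℝ} {𝔸 : Visc4 d}
    {b w : ℝ → UnitAddTorus d → EuclideanSpace ℝ d} {w₀ : UnitAddTorus d → EuclideanSpace ℝ d}
    (h : IsWeakTensorPassiveVectorOn A T 𝔸 b w₀ w) :
    IsWeakTensorPassiveVectorForcedOn A T 𝔸 b (fun _ _ => 0) (fun _ _ _ => 0) w₀ w :=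
  isWeakTensorPassiveVectorForcedOn_zero_iff.2 h

namespace IsWeakTensorPassiveVectorForcedOn

variable {A T : ℝ} {𝔸 : Visc4 d} {b g w : ℝ → UnitAddTorus d → EuclideanSpace ℝ d}
  {F : d → ℝ → UnitAddTorus d → EuclideanSpace ℝ d}
  {w₀ : UnitAddTorus d → EuclideanSpace ℝ d} {Ψ : ℝ → UnitAddTorus d → EuclideanSpace ℝ d}

/-- A forced weak solution with zero forcing is an unforced weak solution.
[cite: Temam1997, Ch. II §3.1–3.2, (3.2)–(3.5), Thm. 3.1] -/
theorem toUnforced (h : IsWeakTensorPassiveVectorForcedOn A T 𝔸 b (fun _ _ => 0) (fun _ _ _ => 0) w₀ w) :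
    IsWeakTensorPassiveVectorOn A T 𝔸 b w₀ w :=
  isWeakTensorPassiveVectorForcedOn_zero_iff.1 h

/-! ## Class API: measurability and integrability (the unforced API verbatim) -/

/-- Joint measurability of `w` on `(0,T) × T^d`. [cite: DiPernaLions1989, §II.1 (12)–(14)] -/
theorem aestronglyMeasurable_uncurry (h : IsWeakTensorPassiveVectorForcedOn A T 𝔸 b g F w₀ w) :
    AEStronglyMeasurable (uncurry w) (((volume : Measure ℝ).restrict (Ioo 0 T)).prod volume) := by
  rw [← volume_restrict_prod_eq]
  exact FunctionSpaces.Torus.aestronglyMeasurable_uncurry_of_stLift_restrict h.aestronglyMeasurable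

/-- Joint measurability of the carrier `b` on `(0,T) × T^d`. [cite: DiPernaLions1989, §II.1 (12)–(14)] -/
theorem aestronglyMeasurable_uncurry_carrier (h : IsWeakTensorPassiveVectorForcedOn A T 𝔸 b g F w₀ w) :
    AEStronglyMeasurable (uncurry b) (((volume : Measure ℝ).restrict (Ioo 0 T)).prod volume) := by
  rw [← volume_restrict_prod_eq]
  exact FunctionSpaces.Torus.aestronglyMeasurable_uncurry_of_stLift_restrict h.aestronglyMeasurable_carrier

/-- Joint measurability of the force `g` on `(0,T) × T^d`. [cite: Temam1997, Ch. II §3.1–3.2, (3.2)–(3.5), Thm. 3.1] -/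
theorem aestronglyMeasurable_uncurry_force (h : IsWeakTensorPassiveVectorForcedOn A T 𝔸 b g F w₀ w) :
    AEStronglyMeasurable (uncurry g) (((volume : Measure ℝ).restrict (Ioo 0 T)).prod volume) := by
  rw [← volume_restrict_prod_eq]
  exact FunctionSpaces.Torus.aestronglyMeasurable_uncurry_of_stLift_restrict h.aestronglyMeasurable_force

/-- Joint measurability of the flux columns `F j` on `(0,T) × T^d`.
[cite: Temam1997, Ch. II §3.1–3.2, (3.2)–(3.5), Thm. 3.1] -/
theorem aestronglyMeasurable_uncurry_flux (h : IsWeakTensorPassiveVectorForcedOn A T 𝔸 b g F w₀ w) (j : d) :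
    AEStronglyMeasurable (uncurry (F j)) (((volume : Measure ℝ).restrict (Ioo 0 T)).prod volume) := by
  rw [← volume_restrict_prod_eq]
  exact FunctionSpaces.Torus.aestronglyMeasurable_uncurry_of_stLift_restrict (h.aestronglyMeasurable_flux j)

/-- Slices are measurable for a.e. `t`: `w t`, `b t`, `g t`, `F j t` a.e. strongly measurable on `T^d`.
[cite: DiPernaLions1989, §II.1 (12)–(14)] -/
theorem ae_aestronglyMeasurable_slice (h : IsWeakTensorPassiveVectorForcedOn A T 𝔸 b g F w₀ w) :
    ∀ᵐ t ∂(volume.restrict (Ioo 0 T)),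
      AEStronglyMeasurable (w t) volume ∧ AEStronglyMeasurable (b t) volume ∧
        AEStronglyMeasurable (g t) volume ∧ ∀ j, AEStronglyMeasurable (F j t) volume := by
  have hF : ∀ᵐ t ∂(volume.restrict (Ioo 0 T)), ∀ j, AEStronglyMeasurable (F j t) volume :=
    ae_all_iff.2 fun j => (h.aestronglyMeasurable_uncurry_flux j).prodMk_left
  filter_upwards [h.aestronglyMeasurable_uncurry.prodMk_left,
    h.aestronglyMeasurable_uncurry_carrier.prodMk_left, h.aestronglyMeasurable_uncurry_force.prodMk_left, hF]
    with t h1 h2 h3 h4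
  exact ⟨h1, h2, h3, h4⟩

/-- The `L^∞_t L²_x` bound in `eLpNorm` form. [cite: DiPernaLions1989, §II.1 (12)–(14)] -/
theorem exists_eLpNorm_le (h : IsWeakTensorPassiveVectorForcedOn A T 𝔸 b g F w₀ w) :
    ∃ C : ℝ≥0, ∀ᵐ t ∂(volume.restrict (Ioo 0 T)), eLpNorm (w t) 2 volume ≤ C := by
  obtain ⟨C, hC⟩ := h.ae_lintegral_sq_le
  refine ⟨NNReal.sqrt C, ?_⟩
  filter_upwards [hC] with t ht
  rw [eLpNorm_eq_lintegral_rpow_enorm_toReal two_ne_zero ENNReal.ofNat_ne_top, ENNReal.toReal_ofNat]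
  have h2 : ∫⁻ x, ‖w t x‖ₑ ^ (2 : ℝ) = ∫⁻ x, ‖w t x‖ₑ ^ 2 := by
    refine lintegral_congr fun x => ?_
    rw [← ENNReal.rpow_two]
  rw [h2]
  calc (∫⁻ x, ‖w t x‖ₑ ^ 2) ^ (1 / (2 : ℝ)) ≤ (C : ℝ≥0∞) ^ (1 / (2 : ℝ)) := by gcongr
    _ = NNReal.sqrt C := by
        rw [← ENNReal.coe_rpow_of_nonneg _ (by norm_num), ← NNReal.sqrt_eq_rpow]

/-- For a.e. `t ∈ (0,T)`, `w t ∈ L²(T^d)`. [cite: DiPernaLions1989, §II.1 (12)–(14)] -/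
theorem ae_memLp_two (h : IsWeakTensorPassiveVectorForcedOn A T 𝔸 b g F w₀ w) :
    ∀ᵐ t ∂(volume.restrict (Ioo 0 T)), MemLp (w t) 2 volume := by
  obtain ⟨C, hC⟩ := h.exists_eLpNorm_le
  filter_upwards [hC, h.aestronglyMeasurable_uncurry.prodMk_left] with t ht hm
  exact ⟨hm, ht.trans_lt ENNReal.coe_lt_top⟩

/-- `w ∈ L¹((0,T) × T^d)`. [cite: DiPernaLions1989, §II.1 (12)–(14)] -/
theorem integrable_uncurry (h : IsWeakTensorPassiveVectorForcedOn A T 𝔸 b g F w₀ w) :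
    Integrable (uncurry w) (((volume : Measure ℝ).restrict (Ioo 0 T)).prod volume) := by
  obtain ⟨C, hC⟩ := h.exists_eLpNorm_le
  refine ⟨h.aestronglyMeasurable_uncurry, ?_⟩
  rw [hasFiniteIntegral_iff_enorm, lintegral_prod _ h.aestronglyMeasurable_uncurry.enorm]
  calc ∫⁻ t in Ioo 0 T, ∫⁻ x, ‖uncurry w (t, x)‖ₑ
      ≤ ∫⁻ _ in Ioo 0 T, (C : ℝ≥0∞) := by
        refine lintegral_mono_ae ?_
        filter_upwards [hC, h.aestronglyMeasurable_uncurry.prodMk_left] with t ht hm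
        calc ∫⁻ x, ‖uncurry w (t, x)‖ₑ = eLpNorm (w t) 1 volume := by
              rw [eLpNorm_one_eq_lintegral_enorm]; rfl
          _ ≤ eLpNorm (w t) 2 volume := eLpNorm_le_eLpNorm_of_exponent_le (by norm_num) hm
          _ ≤ C := ht
    _ < ⊤ := by
        rw [setLIntegral_const]
        exact ENNReal.mul_lt_top ENNReal.coe_lt_top measure_Ioo_lt_top

/-- `‖b‖ ‖w‖ ∈ L¹((0,T) × T^d)`. [cite: DiPernaLions1989, §II.1 (12)–(14)] -/
theorem integrable_norm_carrier_mul_norm (h : IsWeakTensorPassiveVectorForcedOn A T 𝔸 b g F w₀ w) :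
    Integrable (fun p : ℝ × UnitAddTorus d => ‖b p.1 p.2‖ * ‖w p.1 p.2‖)
      (((volume : Measure ℝ).restrict (Ioo 0 T)).prod volume) := by
  have hm : AEStronglyMeasurable (fun p : ℝ × UnitAddTorus d => ‖b p.1 p.2‖ * ‖w p.1 p.2‖)
      (((volume : Measure ℝ).restrict (Ioo 0 T)).prod volume) :=
    h.aestronglyMeasurable_uncurry_carrier.norm.mul h.aestronglyMeasurable_uncurry.norm
  refine ⟨hm, ?_⟩
  rw [hasFiniteIntegral_iff_enorm, lintegral_prod _ hm.enorm]
  simpa only [enorm_mul, enorm_norm] using h.lintegral_mul_lt_top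

/-! ## The forcing in product-measure form -/

omit [DecidableEq d] in
/-- A jointly measurable space–time field with `∫₀ᵀ ∫ ‖G‖² < ∞` (iterated) lies in `L²` of the product
measure `vol|_{(0,T)} ⊗ vol`. [folklore] -/
private theorem memLp_two_uncurry_of_lintegral₇ {G : ℝ → UnitAddTorus d → EuclideanSpace ℝ d} {T : ℝ}
    (hm : AEStronglyMeasurable (uncurry G) (((volume : Measure ℝ).restrict (Ioo 0 T)).prod volume))
    (hG : ∫⁻ t in Ioo 0 T, ∫⁻ x, ‖G t x‖ₑ ^ 2 < ∞) :
    MemLp (uncurry G) 2 (((volume : Measure ℝ).restrict (Ioo 0 T)).prod volume) := by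
  refine ⟨hm, ?_⟩
  rw [eLpNorm_lt_top_iff_lintegral_rpow_enorm_lt_top two_ne_zero ENNReal.ofNat_ne_top, ENNReal.toReal_ofNat]
  have hmeas : AEMeasurable (fun p : ℝ × UnitAddTorus d => ‖uncurry G p‖ₑ ^ 2)
      (((volume : Measure ℝ).restrict (Ioo 0 T)).prod volume) := hm.enorm.pow_const 2
  have e : ∫⁻ p, ‖uncurry G p‖ₑ ^ (2 : ℝ) ∂(((volume : Measure ℝ).restrict (Ioo 0 T)).prod volume) =
      ∫⁻ t in Ioo 0 T, ∫⁻ x, ‖G t x‖ₑ ^ 2 := by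
    have e1 : (fun p : ℝ × UnitAddTorus d => ‖uncurry G p‖ₑ ^ (2 : ℝ)) = fun p => ‖uncurry G p‖ₑ ^ 2 := by
      funext p; rw [ENNReal.rpow_two]
    rw [e1, lintegral_prod _ hmeas]
    rfl
  rw [e]
  exact hG

omit [DecidableEq d] in
/-- Conversely, an `L²` field of the product measure has `∫₀ᵀ ∫ ‖G‖² < ∞` (iterated). [folklore] -/
private theorem lintegral_lt_top_of_memLp_two_uncurry₇ {G : ℝ → UnitAddTorus d → EuclideanSpace ℝ d} {T : ℝ}
    (hG : MemLp (uncurry G) 2 (((volume : Measure ℝ).restrict (Ioo 0 T)).prod volume)) :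
    ∫⁻ t in Ioo 0 T, ∫⁻ x, ‖G t x‖ₑ ^ 2 < ∞ := by
  have h2 := hG.2
  rw [eLpNorm_lt_top_iff_lintegral_rpow_enorm_lt_top two_ne_zero ENNReal.ofNat_ne_top, ENNReal.toReal_ofNat] at h2
  have hmeas : AEMeasurable (fun p : ℝ × UnitAddTorus d => ‖uncurry G p‖ₑ ^ 2)
      (((volume : Measure ℝ).restrict (Ioo 0 T)).prod volume) := hG.1.enorm.pow_const 2
  have e : ∫⁻ p, ‖uncurry G p‖ₑ ^ (2 : ℝ) ∂(((volume : Measure ℝ).restrict (Ioo 0 T)).prod volume) =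
      ∫⁻ t in Ioo 0 T, ∫⁻ x, ‖G t x‖ₑ ^ 2 := by
    have e1 : (fun p : ℝ × UnitAddTorus d => ‖uncurry G p‖ₑ ^ (2 : ℝ)) = fun p => ‖uncurry G p‖ₑ ^ 2 := by
      funext p; rw [ENNReal.rpow_two]
    rw [e1, lintegral_prod _ hmeas]
    rfl
  rwa [e] at h2

/-- The force `g ∈ L²` of the product measure `vol|_{(0,T)} ⊗ vol`.
[cite: Temam1997, Ch. II §3.1–3.2, (3.2)–(3.5), Thm. 3.1] -/
theorem memLp_two_uncurry_force (h : IsWeakTensorPassiveVectorForcedOn A T 𝔸 b g F w₀ w) :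
    MemLp (uncurry g) 2 (((volume : Measure ℝ).restrict (Ioo 0 T)).prod volume) :=
  memLp_two_uncurry_of_lintegral₇ h.aestronglyMeasurable_uncurry_force h.lintegral_force_sq_lt_top

/-- The flux columns `F j ∈ L²` of the product measure `vol|_{(0,T)} ⊗ vol`.
[cite: Temam1997, Ch. II §3.1–3.2, (3.2)–(3.5), Thm. 3.1] -/
theorem memLp_two_uncurry_flux (h : IsWeakTensorPassiveVectorForcedOn A T 𝔸 b g F w₀ w) (j : d) :
    MemLp (uncurry (F j)) 2 (((volume : Measure ℝ).restrict (Ioo 0 T)).prod volume) :=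
  memLp_two_uncurry_of_lintegral₇ (h.aestronglyMeasurable_uncurry_flux j) (h.lintegral_flux_sq_lt_top j)

/-- `g ∈ L¹((0,T) × T^d)` (finite measure). [cite: Temam1997, Ch. II §3.1–3.2, (3.2)–(3.5), Thm. 3.1] -/
theorem integrable_uncurry_force (h : IsWeakTensorPassiveVectorForcedOn A T 𝔸 b g F w₀ w) :
    Integrable (uncurry g) (((volume : Measure ℝ).restrict (Ioo 0 T)).prod volume) :=
  h.memLp_two_uncurry_force.integrable one_le_two

/-- `F j ∈ L¹((0,T) × T^d)` (finite measure). [cite: Temam1997, Ch. II §3.1–3.2, (3.2)–(3.5), Thm. 3.1] -/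
theorem integrable_uncurry_flux (h : IsWeakTensorPassiveVectorForcedOn A T 𝔸 b g F w₀ w) (j : d) :
    Integrable (uncurry (F j)) (((volume : Measure ℝ).restrict (Ioo 0 T)).prod volume) :=
  (h.memLp_two_uncurry_flux j).integrable one_le_two

/-- For a.e. `t ∈ (0,T)`: `g t ∈ L²(T^d)` and every `F j t ∈ L²(T^d)`.
[cite: Temam1997, Ch. II §3.1–3.2, (3.2)–(3.5), Thm. 3.1] -/
theorem ae_memLp_two_force_flux (h : IsWeakTensorPassiveVectorForcedOn A T 𝔸 b g F w₀ w) :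
    ∀ᵐ t ∂(volume.restrict (Ioo 0 T)), MemLp (g t) 2 volume ∧ ∀ j, MemLp (F j t) 2 volume := by
  have hg : ∀ᵐ t ∂(volume.restrict (Ioo 0 T)), ∫⁻ x, ‖g t x‖ₑ ^ 2 < ∞ :=
    ae_lt_top' (h.aestronglyMeasurable_uncurry_force.enorm.pow_const 2).lintegral_prod_right'
      h.lintegral_force_sq_lt_top.ne
  have hF : ∀ᵐ t ∂(volume.restrict (Ioo 0 T)), ∀ j, ∫⁻ x, ‖F j t x‖ₑ ^ 2 < ∞ :=
    ae_all_iff.2 fun j => ae_lt_top' ((h.aestronglyMeasurable_uncurry_flux j).enorm.pow_const 2).lintegral_prod_right'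
      (h.lintegral_flux_sq_lt_top j).ne
  have key : ∀ {v : UnitAddTorus d → EuclideanSpace ℝ d}, AEStronglyMeasurable v volume →
      ∫⁻ x, ‖v x‖ₑ ^ 2 < ∞ → MemLp v 2 volume := by
    intro v hv hlt
    refine ⟨hv, ?_⟩
    rw [eLpNorm_lt_top_iff_lintegral_rpow_enorm_lt_top two_ne_zero ENNReal.ofNat_ne_top, ENNReal.toReal_ofNat]
    simp_rw [ENNReal.rpow_two]
    exact hlt
  filter_upwards [hg, hF, h.ae_aestronglyMeasurable_slice] with t h1 h2 h3
  exact ⟨key h3.2.2.1 h1, fun j => key (h3.2.2.2 j) (h2 j)⟩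

/-! ## Integrability of the pairings -/

omit [DecidableEq d] in
/-- Points of `(0,T) × T^d` have their time coordinate in `(0,T)`, a.e. [folklore] -/
private theorem ae_fst_mem_Ioo₇ (T : ℝ) :
    ∀ᵐ p : ℝ × UnitAddTorus d ∂(((volume : Measure ℝ).restrict (Ioo 0 T)).prod volume),
      p.1 ∈ Ioo 0 T :=
  (Measure.quasiMeasurePreserving_fst (μ := (volume : Measure ℝ).restrict (Ioo 0 T))
    (ν := (volume : Measure (UnitAddTorus d)))).ae (ae_restrict_mem measurableSet_Ioo)

omit [DecidableEq d] in
/-- Integrability on `(0,T) × T^d` of `⟪G, Φ⟫` for an integrable field `G` and a jointly continuous `Φ`.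
[folklore] -/
private theorem integrable_inner_of_integrable_of_continuous₇ {G Φ : ℝ → UnitAddTorus d → EuclideanSpace ℝ d} {T : ℝ}
    (hG : Integrable (uncurry G) (((volume : Measure ℝ).restrict (Ioo 0 T)).prod volume))
    (hΦ : Continuous (uncurry Φ)) :
    Integrable (fun p : ℝ × UnitAddTorus d => ⟪G p.1 p.2, Φ p.1 p.2⟫_ℝ)
      (((volume : Measure ℝ).restrict (Ioo 0 T)).prod volume) := by
  obtain ⟨C₀, hC₀⟩ := exists_bound_of_continuous_uncurry hΦ 0 T
  refine Integrable.mono' (g := fun p : ℝ × UnitAddTorus d => ‖uncurry G p‖ * C₀)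
    (hG.norm.mul_const C₀) (hG.1.inner hΦ.aestronglyMeasurable) ?_
  filter_upwards [ae_fst_mem_Ioo₇ (d := d) T] with p hp
  exact (norm_inner_le_norm _ _).trans (mul_le_mul_of_nonneg_left (hC₀ p.1 (Ioo_subset_Icc_self hp) p.2) (norm_nonneg _))

/-- Integrability on `(0,T) × T^d` of `⟪w, Φ⟫` for a jointly continuous field `Φ`.
[cite: DiPernaLions1989, §II.1 (12)–(14)] -/
theorem integrable_inner_of_continuous (h : IsWeakTensorPassiveVectorForcedOn A T 𝔸 b g F w₀ w)
    {Φ : ℝ → UnitAddTorus d → EuclideanSpace ℝ d} (hΦ : Continuous (uncurry Φ)) :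
    Integrable (fun p : ℝ × UnitAddTorus d => ⟪w p.1 p.2, Φ p.1 p.2⟫_ℝ)
      (((volume : Measure ℝ).restrict (Ioo 0 T)).prod volume) :=
  integrable_inner_of_integrable_of_continuous₇ h.integrable_uncurry hΦ

/-- Integrability on `(0,T) × T^d` of the force pairing `⟪g, Φ⟫` for a jointly continuous field `Φ`.
[cite: Temam1997, Ch. II §3.1–3.2, (3.2)–(3.5), Thm. 3.1] -/
theorem integrable_inner_force_of_continuous (h : IsWeakTensorPassiveVectorForcedOn A T 𝔸 b g F w₀ w)
    {Φ : ℝ → UnitAddTorus d → EuclideanSpace ℝ d} (hΦ : Continuous (uncurry Φ)) :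
    Integrable (fun p : ℝ × UnitAddTorus d => ⟪g p.1 p.2, Φ p.1 p.2⟫_ℝ)
      (((volume : Measure ℝ).restrict (Ioo 0 T)).prod volume) :=
  integrable_inner_of_integrable_of_continuous₇ h.integrable_uncurry_force hΦ

/-- Integrability on `(0,T) × T^d` of the flux pairings `⟪F j, Φ⟫` for a jointly continuous field `Φ`.
[cite: Temam1997, Ch. II §3.1–3.2, (3.2)–(3.5), Thm. 3.1] -/
theorem integrable_inner_flux_of_continuous (h : IsWeakTensorPassiveVectorForcedOn A T 𝔸 b g F w₀ w)
    {Φ : ℝ → UnitAddTorus d → EuclideanSpace ℝ d} (hΦ : Continuous (uncurry Φ)) (j : d) :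
    Integrable (fun p : ℝ × UnitAddTorus d => ⟪F j p.1 p.2, Φ p.1 p.2⟫_ℝ)
      (((volume : Measure ℝ).restrict (Ioo 0 T)).prod volume) :=
  integrable_inner_of_integrable_of_continuous₇ (h.integrable_uncurry_flux j) hΦ

/-- Integrability on `(0,T) × T^d` of `bⱼ ⟪w, Φ⟫` for a jointly continuous field `Φ`.
[cite: DiPernaLions1989, §II.1 (12)–(14)] -/
theorem integrable_carrier_mul_inner_of_continuous (h : IsWeakTensorPassiveVectorForcedOn A T 𝔸 b g F w₀ w)
    {Φ : ℝ → UnitAddTorus d → EuclideanSpace ℝ d} (hΦ : Continuous (uncurry Φ)) (j : d) :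
    Integrable (fun p : ℝ × UnitAddTorus d => b p.1 p.2 j * ⟪w p.1 p.2, Φ p.1 p.2⟫_ℝ)
      (((volume : Measure ℝ).restrict (Ioo 0 T)).prod volume) := by
  obtain ⟨C₀, hC₀⟩ := exists_bound_of_continuous_uncurry hΦ 0 T
  have hm : AEStronglyMeasurable (fun p : ℝ × UnitAddTorus d => b p.1 p.2 j * ⟪w p.1 p.2, Φ p.1 p.2⟫_ℝ)
      (((volume : Measure ℝ).restrict (Ioo 0 T)).prod volume) :=
    ((EuclideanSpace.proj j).continuous.comp_aestronglyMeasurable h.aestronglyMeasurable_uncurry_carrier).mul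
      (h.aestronglyMeasurable_uncurry.inner hΦ.aestronglyMeasurable)
  refine Integrable.mono' (g := fun p : ℝ × UnitAddTorus d => ‖b p.1 p.2‖ * ‖w p.1 p.2‖ * C₀)
    (h.integrable_norm_carrier_mul_norm.mul_const C₀) hm ?_
  filter_upwards [ae_fst_mem_Ioo₇ (d := d) T] with p hp
  rw [norm_mul]
  calc ‖b p.1 p.2 j‖ * ‖⟪w p.1 p.2, Φ p.1 p.2⟫_ℝ‖ ≤ ‖b p.1 p.2‖ * (‖w p.1 p.2‖ * C₀) :=
        mul_le_mul (by simpa [Real.norm_eq_abs] using FunctionSpaces.Torus.abs_apply_le_norm (b p.1 p.2) j)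
          ((norm_inner_le_norm _ _).trans (mul_le_mul_of_nonneg_left (hC₀ p.1 (Ioo_subset_Icc_self hp) p.2)
            (norm_nonneg _))) (norm_nonneg _) (norm_nonneg _)
    _ = ‖b p.1 p.2‖ * ‖w p.1 p.2‖ * C₀ := by ring

/-- Integrability on `(0,T) × T^d` of `wⱼ ⟪b, Φ⟫` for a jointly continuous field `Φ`.
[cite: DiPernaLions1989, §II.1 (12)–(14)] -/
theorem integrable_mul_inner_carrier_of_continuous (h : IsWeakTensorPassiveVectorForcedOn A T 𝔸 b g F w₀ w)
    {Φ : ℝ → UnitAddTorus d → EuclideanSpace ℝ d} (hΦ : Continuous (uncurry Φ)) (j : d) :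
    Integrable (fun p : ℝ × UnitAddTorus d => w p.1 p.2 j * ⟪b p.1 p.2, Φ p.1 p.2⟫_ℝ)
      (((volume : Measure ℝ).restrict (Ioo 0 T)).prod volume) := by
  obtain ⟨C₀, hC₀⟩ := exists_bound_of_continuous_uncurry hΦ 0 T
  have hm : AEStronglyMeasurable (fun p : ℝ × UnitAddTorus d => w p.1 p.2 j * ⟪b p.1 p.2, Φ p.1 p.2⟫_ℝ)
      (((volume : Measure ℝ).restrict (Ioo 0 T)).prod volume) :=
    ((EuclideanSpace.proj j).continuous.comp_aestronglyMeasurable h.aestronglyMeasurable_uncurry).mul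
      (h.aestronglyMeasurable_uncurry_carrier.inner hΦ.aestronglyMeasurable)
  refine Integrable.mono' (g := fun p : ℝ × UnitAddTorus d => ‖b p.1 p.2‖ * ‖w p.1 p.2‖ * C₀)
    (h.integrable_norm_carrier_mul_norm.mul_const C₀) hm ?_
  filter_upwards [ae_fst_mem_Ioo₇ (d := d) T] with p hp
  rw [norm_mul]
  calc ‖w p.1 p.2 j‖ * ‖⟪b p.1 p.2, Φ p.1 p.2⟫_ℝ‖ ≤ ‖w p.1 p.2‖ * (‖b p.1 p.2‖ * C₀) :=
        mul_le_mul (by simpa [Real.norm_eq_abs] using FunctionSpaces.Torus.abs_apply_le_norm (w p.1 p.2) j)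
          ((norm_inner_le_norm _ _).trans (mul_le_mul_of_nonneg_left (hC₀ p.1 (Ioo_subset_Icc_self hp) p.2)
            (norm_nonneg _))) (norm_nonneg _) (norm_nonneg _)
    _ = ‖b p.1 p.2‖ * ‖w p.1 p.2‖ * C₀ := by ring

/-- Integrability on `(0,T) × T^d` of the transport pairing `⟪w, (b(t)·∇)Φ(t)⟫` for a field `Φ`
smooth in space with jointly continuous partial derivatives. [cite: DiPernaLions1989, §II.1 (12)–(14)] -/
theorem integrable_inner_convect (h : IsWeakTensorPassiveVectorForcedOn A T 𝔸 b g F w₀ w)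
    {Φ : ℝ → UnitAddTorus d → EuclideanSpace ℝ d} (hΦ1 : ∀ t, FunctionSpaces.Torus.IsContDiff 1 (Φ t))
    (hΦd : ∀ j, Continuous (uncurry fun t x => FunctionSpaces.Torus.partialDeriv j (Φ t) x)) :
    Integrable (fun p : ℝ × UnitAddTorus d => ⟪w p.1 p.2, FunctionSpaces.Torus.convect (b p.1) (Φ p.1) p.2⟫_ℝ)
      (((volume : Measure ℝ).restrict (Ioo 0 T)).prod volume) := by
  have e : (fun p : ℝ × UnitAddTorus d => ⟪w p.1 p.2, FunctionSpaces.Torus.convect (b p.1) (Φ p.1) p.2⟫_ℝ) =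
      fun p => ∑ j, b p.1 p.2 j * ⟪w p.1 p.2, FunctionSpaces.Torus.partialDeriv j (Φ p.1) p.2⟫_ℝ := by
    funext p
    exact IsWeakPassiveVectorOn.inner_convect_eq_sum' (hΦ1 p.1) _ _ _
  rw [e]
  exact integrable_finsetSum _ fun j _ => h.integrable_carrier_mul_inner_of_continuous (hΦd j) j

/-- Integrability on `(0,T) × T^d` of the stretching pairing `⟪b, (w(t)·∇)Φ(t)⟫` under the same
hypotheses. [cite: DiPernaLions1989, §II.1 (12)–(14)] -/
theorem integrable_inner_carrier_convect (h : IsWeakTensorPassiveVectorForcedOn A T 𝔸 b g F w₀ w)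
    {Φ : ℝ → UnitAddTorus d → EuclideanSpace ℝ d} (hΦ1 : ∀ t, FunctionSpaces.Torus.IsContDiff 1 (Φ t))
    (hΦd : ∀ j, Continuous (uncurry fun t x => FunctionSpaces.Torus.partialDeriv j (Φ t) x)) :
    Integrable (fun p : ℝ × UnitAddTorus d => ⟪b p.1 p.2, FunctionSpaces.Torus.convect (w p.1) (Φ p.1) p.2⟫_ℝ)
      (((volume : Measure ℝ).restrict (Ioo 0 T)).prod volume) := by
  have e : (fun p : ℝ × UnitAddTorus d => ⟪b p.1 p.2, FunctionSpaces.Torus.convect (w p.1) (Φ p.1) p.2⟫_ℝ) =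
      fun p => ∑ j, w p.1 p.2 j * ⟪b p.1 p.2, FunctionSpaces.Torus.partialDeriv j (Φ p.1) p.2⟫_ℝ := by
    funext p
    exact IsWeakPassiveVectorOn.inner_convect_eq_sum' (hΦ1 p.1) _ _ _
  rw [e]
  exact integrable_finsetSum _ fun j _ => h.integrable_mul_inner_carrier_of_continuous (hΦd j) j

/-! ## The weak identity in product-measure form -/

omit [DecidableEq d] in
/-- Partial derivatives `(t, x) ↦ ∂ⱼ(Ψ t)(x)` of a space–time test field are jointly continuous. [folklore] -/
private theorem continuous_uncurry_partialDeriv₇ [DecidableEq d] {E : Type*} [NormedAddCommGroup E] [NormedSpace ℝ E]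
    {T : ℝ} {ψ : ℝ → UnitAddTorus d → E} (hψ : FunctionSpaces.Torus.IsSpaceTimeTest T ψ) (j : d) :
    Continuous (uncurry fun t x => FunctionSpaces.Torus.partialDeriv j (ψ t) x) :=
  hψ.continuous_uncurry_lineDeriv (EuclideanSpace.single j 1)

/-- **Integrability of the weak integrand** `⟪w, ∂ₜΨ + (b·∇)Ψ + 𝓛_𝔸^*Ψ⟫ + A ⟪b, (w·∇)Ψ⟫` on
`(0,T) × T^d` for a forced weak solution and a (vector) space–time test field `Ψ`.
[cite: DiPernaLions1989, §II.1 (12)–(14)] -/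
theorem integrable_weakIntegrand (h : IsWeakTensorPassiveVectorForcedOn A T 𝔸 b g F w₀ w)
    (hΨ : FunctionSpaces.Torus.IsSpaceTimeTest T Ψ) :
    Integrable (fun p : ℝ × UnitAddTorus d =>
      ⟪w p.1 p.2, FunctionSpaces.Torus.timeDeriv Ψ p.1 p.2 +
          FunctionSpaces.Torus.convect (b p.1) (Ψ p.1) p.2 + viscAdj 𝔸 (Ψ p.1) p.2⟫_ℝ +
        A * ⟪b p.1 p.2, FunctionSpaces.Torus.convect (w p.1) (Ψ p.1) p.2⟫_ℝ)
      (((volume : Measure ℝ).restrict (Ioo 0 T)).prod volume) := by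
  have hΨ1 : ∀ t, FunctionSpaces.Torus.IsContDiff 1 (Ψ t) := fun t => (hΨ.isSmooth_slice t).isContDiff (by simp)
  have hΨd : ∀ j, Continuous (uncurry fun t x => FunctionSpaces.Torus.partialDeriv j (Ψ t) x) :=
    fun j => continuous_uncurry_partialDeriv₇ hΨ j
  have e : (fun p : ℝ × UnitAddTorus d =>
      ⟪w p.1 p.2, FunctionSpaces.Torus.timeDeriv Ψ p.1 p.2 +
          FunctionSpaces.Torus.convect (b p.1) (Ψ p.1) p.2 + viscAdj 𝔸 (Ψ p.1) p.2⟫_ℝ +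
        A * ⟪b p.1 p.2, FunctionSpaces.Torus.convect (w p.1) (Ψ p.1) p.2⟫_ℝ) =
      fun p => (⟪w p.1 p.2, FunctionSpaces.Torus.timeDeriv Ψ p.1 p.2⟫_ℝ +
        ⟪w p.1 p.2, FunctionSpaces.Torus.convect (b p.1) (Ψ p.1) p.2⟫_ℝ +
        ⟪w p.1 p.2, (fun t x => viscAdj 𝔸 (Ψ t) x) p.1 p.2⟫_ℝ) +
        A * ⟪b p.1 p.2, FunctionSpaces.Torus.convect (w p.1) (Ψ p.1) p.2⟫_ℝ := by
    funext p
    rw [inner_add_right, inner_add_right]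
  rw [e]
  refine (((h.integrable_inner_of_continuous hΨ.continuous_uncurry_timeDeriv).add
    (h.integrable_inner_convect hΨ1 hΨd)).add
    (h.integrable_inner_of_continuous (IsWeakTensorPassiveVectorOn.continuous_uncurry_viscAdj 𝔸 hΨ))).add
    ((h.integrable_inner_carrier_convect hΨ1 hΨd).const_mul A)

/-- **Integrability of the forcing integrand** `⟪g, Ψ⟫ − Σⱼ ⟪F j, ∂ⱼΨ⟫` on `(0,T) × T^d` for a
forced weak solution and a space–time test field `Ψ`. [cite: Temam1997, Ch. II §3.1–3.2, (3.2)–(3.5), Thm. 3.1] -/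
theorem integrable_forceIntegrand (h : IsWeakTensorPassiveVectorForcedOn A T 𝔸 b g F w₀ w)
    (hΨ : FunctionSpaces.Torus.IsSpaceTimeTest T Ψ) :
    Integrable (fun p : ℝ × UnitAddTorus d =>
      ⟪g p.1 p.2, Ψ p.1 p.2⟫_ℝ - ∑ j, ⟪F j p.1 p.2, FunctionSpaces.Torus.partialDeriv j (Ψ p.1) p.2⟫_ℝ)
      (((volume : Measure ℝ).restrict (Ioo 0 T)).prod volume) :=
  (h.integrable_inner_force_of_continuous hΨ.continuous_uncurry).sub
    (integrable_finsetSum _ fun j _ =>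
      h.integrable_inner_flux_of_continuous (continuous_uncurry_partialDeriv₇ hΨ j) j)

/-- The weak identity in product-measure form:
`∫_{(0,T)×T^d} (⟪w, ∂ₜΨ + (b·∇)Ψ + 𝓛_𝔸^*Ψ⟫ + A ⟪b, (w·∇)Ψ⟫) + ∫_{(0,T)×T^d} (⟪g, Ψ⟫ − Σⱼ ⟪F j, ∂ⱼΨ⟫) + ∫ ⟪w₀, Ψ(0)⟫ = 0`.
[cite: Temam1997, Ch. II §3.1–3.2, (3.2)–(3.5), Thm. 3.1] -/
theorem integral_prod_weak_eq (h : IsWeakTensorPassiveVectorForcedOn A T 𝔸 b g F w₀ w)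
    (hΨ : FunctionSpaces.Torus.IsSpaceTimeTest T Ψ) (hΨdiv : ∀ t, FunctionSpaces.Torus.IsDivFree (Ψ t)) :
    (∫ p : ℝ × UnitAddTorus d,
      (⟪w p.1 p.2, FunctionSpaces.Torus.timeDeriv Ψ p.1 p.2 +
          FunctionSpaces.Torus.convect (b p.1) (Ψ p.1) p.2 + viscAdj 𝔸 (Ψ p.1) p.2⟫_ℝ +
        A * ⟪b p.1 p.2, FunctionSpaces.Torus.convect (w p.1) (Ψ p.1) p.2⟫_ℝ)
      ∂(((volume : Measure ℝ).restrict (Ioo 0 T)).prod volume)) +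
      (∫ p : ℝ × UnitAddTorus d,
        (⟪g p.1 p.2, Ψ p.1 p.2⟫_ℝ - ∑ j, ⟪F j p.1 p.2, FunctionSpaces.Torus.partialDeriv j (Ψ p.1) p.2⟫_ℝ)
        ∂(((volume : Measure ℝ).restrict (Ioo 0 T)).prod volume)) +
      ∫ x, ⟪w₀ x, Ψ 0 x⟫_ℝ = 0 := by
  rw [integral_prod _ (h.integrable_weakIntegrand hΨ), integral_prod _ (h.integrable_forceIntegrand hΨ)]
  exact h.weak_eq Ψ hΨ hΨdiv

/-! ## Linearity of the forced weak formulation in `(g, F, w₀, w)` -/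

section Superposition

variable {g₁ g₂ u v : ℝ → UnitAddTorus d → EuclideanSpace ℝ d} {F₁ F₂ : d → ℝ → UnitAddTorus d → EuclideanSpace ℝ d}
  {u₀ v₀ : UnitAddTorus d → EuclideanSpace ℝ d}

/-- `‖b‖ ‖u + v‖ ∈ L¹((0,T) × T^d)` for two forced weak solutions with the same carrier
(iterated-`lintegral` form of the class). [cite: DiPernaLions1989, §II.1 (12)–(14)] -/
theorem lintegral_mul_add_lt_top (h₁ : IsWeakTensorPassiveVectorForcedOn A T 𝔸 b g₁ F₁ u₀ u)
    (h₂ : IsWeakTensorPassiveVectorForcedOn A T 𝔸 b g₂ F₂ v₀ v) :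
    ∫⁻ t in Ioo 0 T, ∫⁻ x, ‖b t x‖ₑ * ‖u t x + v t x‖ₑ < ⊤ := by
  set μT : Measure ℝ := (volume : Measure ℝ).restrict (Ioo 0 T) with hμT
  have hmu := h₁.aestronglyMeasurable_uncurry_carrier
  have hm₁ := h₁.aestronglyMeasurable_uncurry
  have hm₂ := h₂.aestronglyMeasurable_uncurry
  have hF : AEMeasurable (fun p : ℝ × UnitAddTorus d => ‖b p.1 p.2‖ₑ * ‖u p.1 p.2 + v p.1 p.2‖ₑ)
      (μT.prod volume) := hmu.enorm.mul (hm₁.add hm₂).enorm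
  have hF₁ : AEMeasurable (fun p : ℝ × UnitAddTorus d => ‖b p.1 p.2‖ₑ * ‖u p.1 p.2‖ₑ) (μT.prod volume) :=
    hmu.enorm.mul hm₁.enorm
  have hF₂ : AEMeasurable (fun p : ℝ × UnitAddTorus d => ‖b p.1 p.2‖ₑ * ‖v p.1 p.2‖ₑ) (μT.prod volume) :=
    hmu.enorm.mul hm₂.enorm
  have e : ∫⁻ t in Ioo 0 T, ∫⁻ x, ‖b t x‖ₑ * ‖u t x + v t x‖ₑ =
      ∫⁻ p, ‖b p.1 p.2‖ₑ * ‖u p.1 p.2 + v p.1 p.2‖ₑ ∂(μT.prod volume) := (lintegral_prod _ hF).symm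
  rw [e]
  calc ∫⁻ p, ‖b p.1 p.2‖ₑ * ‖u p.1 p.2 + v p.1 p.2‖ₑ ∂(μT.prod volume)
      ≤ ∫⁻ p, (‖b p.1 p.2‖ₑ * ‖u p.1 p.2‖ₑ + ‖b p.1 p.2‖ₑ * ‖v p.1 p.2‖ₑ) ∂(μT.prod volume) := by
        refine lintegral_mono fun p => ?_
        rw [← mul_add]
        gcongr
        exact enorm_add_le _ _
    _ = (∫⁻ p, ‖b p.1 p.2‖ₑ * ‖u p.1 p.2‖ₑ ∂(μT.prod volume)) +
          ∫⁻ p, ‖b p.1 p.2‖ₑ * ‖v p.1 p.2‖ₑ ∂(μT.prod volume) := lintegral_add_left' hF₁ _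
    _ = (∫⁻ t in Ioo 0 T, ∫⁻ x, ‖b t x‖ₑ * ‖u t x‖ₑ) + ∫⁻ t in Ioo 0 T, ∫⁻ x, ‖b t x‖ₑ * ‖v t x‖ₑ := by
        rw [lintegral_prod _ hF₁, lintegral_prod _ hF₂]
    _ < ⊤ := ENNReal.add_lt_top.2 ⟨h₁.lintegral_mul_lt_top, h₂.lintegral_mul_lt_top⟩

/-- `u + v ∈ L^∞(0,T; L²)`: `∫ ‖u(t) + v(t)‖² ≤ (C₁ + C₂)²` for a.e. `t`. [cite: DiPernaLions1989, §II.1 (12)–(14)] -/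
theorem ae_lintegral_sq_add_le (h₁ : IsWeakTensorPassiveVectorForcedOn A T 𝔸 b g₁ F₁ u₀ u)
    (h₂ : IsWeakTensorPassiveVectorForcedOn A T 𝔸 b g₂ F₂ v₀ v) :
    ∃ C : ℝ≥0, ∀ᵐ t ∂(volume.restrict (Ioo 0 T)), ∫⁻ x, ‖u t x + v t x‖ₑ ^ 2 ≤ C := by
  obtain ⟨C₁, hC₁⟩ := h₁.exists_eLpNorm_le
  obtain ⟨C₂, hC₂⟩ := h₂.exists_eLpNorm_le
  refine ⟨(C₁ + C₂) ^ 2, ?_⟩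
  filter_upwards [hC₁, hC₂, h₁.ae_memLp_two, h₂.ae_memLp_two] with t hc₁ hc₂ hm₁ hm₂
  have hadd : eLpNorm (u t + v t) 2 volume ≤ C₁ + C₂ :=
    (eLpNorm_add_le hm₁.1 hm₂.1 one_le_two).trans (add_le_add hc₁ hc₂)
  have e : ∫⁻ x, ‖u t x + v t x‖ₑ ^ 2 = eLpNorm (u t + v t) 2 volume ^ 2 := by
    rw [eLpNorm_eq_lintegral_rpow_enorm_toReal two_ne_zero ENNReal.ofNat_ne_top, ENNReal.toReal_ofNat,
      ← ENNReal.rpow_natCast, ← ENNReal.rpow_mul]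
    norm_num
  rw [e, ENNReal.coe_pow, ENNReal.coe_add]
  exact pow_le_pow_left' hadd 2

/-- **Superposition of forced weak tensor-viscosity passive-vector solutions.** If `u`, `v` are forced
weak solutions along the same carrier `b`, with the same coupling `A` and tensor `𝔸`, forcings
`(g₁, F₁)`, `(g₂, F₂)` and integrable data `u₀`, `v₀`, then `u + v` is a forced weak solution with
forcing `(g₁ + g₂, F₁ + F₂)` from `u₀ + v₀`: the weak formulation is linear in `(g, F, w₀, w)` and the
bookkeeping clauses are closed under sums. [cite: Temam1997, Ch. II §3.1–3.2, (3.2)–(3.5), Thm. 3.1] -/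
theorem add (h₁ : IsWeakTensorPassiveVectorForcedOn A T 𝔸 b g₁ F₁ u₀ u)
    (h₂ : IsWeakTensorPassiveVectorForcedOn A T 𝔸 b g₂ F₂ v₀ v)
    (hu₀ : Integrable u₀ volume) (hv₀ : Integrable v₀ volume) :
    IsWeakTensorPassiveVectorForcedOn A T 𝔸 b (fun t x => g₁ t x + g₂ t x) (fun j t x => F₁ j t x + F₂ j t x)
      (fun x => u₀ x + v₀ x) (fun t x => u t x + v t x) where
  aestronglyMeasurable := h₁.aestronglyMeasurable.add h₂.aestronglyMeasurable
  aestronglyMeasurable_carrier := h₁.aestronglyMeasurable_carrier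
  ae_lintegral_sq_le := ae_lintegral_sq_add_le h₁ h₂
  lintegral_carrier_lt_top := h₁.lintegral_carrier_lt_top
  lintegral_mul_lt_top := lintegral_mul_add_lt_top h₁ h₂
  ae_isWeaklyDivFree_carrier := h₁.ae_isWeaklyDivFree_carrier
  ae_isWeaklyDivFree := by
    filter_upwards [h₁.ae_isWeaklyDivFree, h₂.ae_isWeaklyDivFree, h₁.ae_memLp_two, h₂.ae_memLp_two]
      with t hd₁ hd₂ hm₁ hm₂
    exact hd₁.add_of_integrable hd₂ (hm₁.integrable one_le_two) (hm₂.integrable one_le_two)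
  aestronglyMeasurable_force := h₁.aestronglyMeasurable_force.add h₂.aestronglyMeasurable_force
  lintegral_force_sq_lt_top :=
    lintegral_lt_top_of_memLp_two_uncurry₇ (G := fun t x => g₁ t x + g₂ t x)
      (h₁.memLp_two_uncurry_force.add h₂.memLp_two_uncurry_force)
  aestronglyMeasurable_flux j := (h₁.aestronglyMeasurable_flux j).add (h₂.aestronglyMeasurable_flux j)
  lintegral_flux_sq_lt_top j :=
    lintegral_lt_top_of_memLp_two_uncurry₇ (G := fun t x => F₁ j t x + F₂ j t x)
      ((h₁.memLp_two_uncurry_flux j).add (h₂.memLp_two_uncurry_flux j))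
  weak_eq Ψ hΨ hΨdiv := by
    have e₁ := h₁.weak_eq Ψ hΨ hΨdiv
    have e₂ := h₂.weak_eq Ψ hΨ hΨdiv
    have hI₁ := h₁.integrable_weakIntegrand hΨ
    have hI₂ := h₂.integrable_weakIntegrand hΨ
    have hJ₁ := h₁.integrable_forceIntegrand hΨ
    have hJ₂ := h₂.integrable_forceIntegrand hΨ
    have hpt : ∀ t x, ⟪u t x + v t x, FunctionSpaces.Torus.timeDeriv Ψ t x +
          FunctionSpaces.Torus.convect (b t) (Ψ t) x + viscAdj 𝔸 (Ψ t) x⟫_ℝ +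
        A * ⟪b t x, FunctionSpaces.Torus.convect (fun y => u t y + v t y) (Ψ t) x⟫_ℝ =
        (⟪u t x, FunctionSpaces.Torus.timeDeriv Ψ t x +
            FunctionSpaces.Torus.convect (b t) (Ψ t) x + viscAdj 𝔸 (Ψ t) x⟫_ℝ +
          A * ⟪b t x, FunctionSpaces.Torus.convect (u t) (Ψ t) x⟫_ℝ) +
        (⟪v t x, FunctionSpaces.Torus.timeDeriv Ψ t x +
            FunctionSpaces.Torus.convect (b t) (Ψ t) x + viscAdj 𝔸 (Ψ t) x⟫_ℝ +
          A * ⟪b t x, FunctionSpaces.Torus.convect (v t) (Ψ t) x⟫_ℝ) := by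
      intro t x
      simp only [FunctionSpaces.Torus.convect, map_add, inner_add_left, inner_add_right]
      ring
    have hptF : ∀ t x, ⟪g₁ t x + g₂ t x, Ψ t x⟫_ℝ -
          ∑ j, ⟪F₁ j t x + F₂ j t x, FunctionSpaces.Torus.partialDeriv j (Ψ t) x⟫_ℝ =
        (⟪g₁ t x, Ψ t x⟫_ℝ - ∑ j, ⟪F₁ j t x, FunctionSpaces.Torus.partialDeriv j (Ψ t) x⟫_ℝ) +
        (⟪g₂ t x, Ψ t x⟫_ℝ - ∑ j, ⟪F₂ j t x, FunctionSpaces.Torus.partialDeriv j (Ψ t) x⟫_ℝ) := by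
      intro t x
      simp only [inner_add_left, Finset.sum_add_distrib]
      ring
    have hslice : ∀ᵐ t ∂(volume.restrict (Ioo 0 T)),
        ∫ x, (⟪u t x + v t x, FunctionSpaces.Torus.timeDeriv Ψ t x +
            FunctionSpaces.Torus.convect (b t) (Ψ t) x + viscAdj 𝔸 (Ψ t) x⟫_ℝ +
          A * ⟪b t x, FunctionSpaces.Torus.convect (fun y => u t y + v t y) (Ψ t) x⟫_ℝ) =
        (∫ x, (⟪u t x, FunctionSpaces.Torus.timeDeriv Ψ t x +
            FunctionSpaces.Torus.convect (b t) (Ψ t) x + viscAdj 𝔸 (Ψ t) x⟫_ℝ +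
          A * ⟪b t x, FunctionSpaces.Torus.convect (u t) (Ψ t) x⟫_ℝ)) +
        ∫ x, (⟪v t x, FunctionSpaces.Torus.timeDeriv Ψ t x +
            FunctionSpaces.Torus.convect (b t) (Ψ t) x + viscAdj 𝔸 (Ψ t) x⟫_ℝ +
          A * ⟪b t x, FunctionSpaces.Torus.convect (v t) (Ψ t) x⟫_ℝ) := by
      filter_upwards [hI₁.prod_right_ae, hI₂.prod_right_ae] with t ht₁ ht₂
      rw [← integral_add ht₁ ht₂]
      exact integral_congr_ae (Eventually.of_forall fun x => hpt t x)
    have hsliceF : ∀ᵐ t ∂(volume.restrict (Ioo 0 T)),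
        ∫ x, (⟪g₁ t x + g₂ t x, Ψ t x⟫_ℝ -
          ∑ j, ⟪F₁ j t x + F₂ j t x, FunctionSpaces.Torus.partialDeriv j (Ψ t) x⟫_ℝ) =
        (∫ x, (⟪g₁ t x, Ψ t x⟫_ℝ - ∑ j, ⟪F₁ j t x, FunctionSpaces.Torus.partialDeriv j (Ψ t) x⟫_ℝ)) +
        ∫ x, (⟪g₂ t x, Ψ t x⟫_ℝ - ∑ j, ⟪F₂ j t x, FunctionSpaces.Torus.partialDeriv j (Ψ t) x⟫_ℝ) := by
      filter_upwards [hJ₁.prod_right_ae, hJ₂.prod_right_ae] with t ht₁ ht₂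
      rw [← integral_add ht₁ ht₂]
      exact integral_congr_ae (Eventually.of_forall fun x => hptF t x)
    -- the datum pairing splits: `Ψ 0` is continuous and the data are integrable
    have hΨ0 : Continuous (Ψ 0) := (hΨ.isSmooth_slice 0).continuous
    have hd : ∫ x, ⟪u₀ x + v₀ x, Ψ 0 x⟫_ℝ = (∫ x, ⟪u₀ x, Ψ 0 x⟫_ℝ) + ∫ x, ⟪v₀ x, Ψ 0 x⟫_ℝ := by
      simp_rw [inner_add_left]
      exact integral_add (FunctionSpaces.Torus.integrable_inner_of_continuous hu₀ hΨ0)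
        (FunctionSpaces.Torus.integrable_inner_of_continuous hv₀ hΨ0)
    rw [integral_congr_ae hslice, integral_add hI₁.integral_prod_left hI₂.integral_prod_left,
      integral_congr_ae hsliceF, integral_add hJ₁.integral_prod_left hJ₂.integral_prod_left, hd]
    linarith

/-- **Constant multiples of forced weak solutions** are forced weak solutions for the multiplied
forcing and datum (linearity of the weak form). [cite: Temam1997, Ch. II §3.1–3.2, (3.2)–(3.5), Thm. 3.1] -/
theorem const_smul (h₁ : IsWeakTensorPassiveVectorForcedOn A T 𝔸 b g₁ F₁ u₀ u) (c : ℝ) :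
    IsWeakTensorPassiveVectorForcedOn A T 𝔸 b (fun t x => c • g₁ t x) (fun j t x => c • F₁ j t x)
      (fun x => c • u₀ x) (fun t x => c • u t x) where
  aestronglyMeasurable := h₁.aestronglyMeasurable.const_smul c
  aestronglyMeasurable_carrier := h₁.aestronglyMeasurable_carrier
  ae_lintegral_sq_le := by
    obtain ⟨C, hC⟩ := h₁.ae_lintegral_sq_le
    refine ⟨‖c‖₊ ^ 2 * C, ?_⟩
    filter_upwards [hC] with t ht
    have e : ∫⁻ x, ‖c • u t x‖ₑ ^ 2 = (‖c‖₊ : ℝ≥0∞) ^ 2 * ∫⁻ x, ‖u t x‖ₑ ^ 2 := by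
      rw [← lintegral_const_mul' _ _ (ENNReal.pow_ne_top ENNReal.coe_ne_top)]
      refine lintegral_congr fun x => ?_
      rw [enorm_smul, mul_pow]
      rfl
    rw [e, ENNReal.coe_mul, ENNReal.coe_pow]
    gcongr
  lintegral_carrier_lt_top := h₁.lintegral_carrier_lt_top
  lintegral_mul_lt_top := by
    have e : ∫⁻ t in Ioo 0 T, ∫⁻ x, ‖b t x‖ₑ * ‖c • u t x‖ₑ =
        (‖c‖₊ : ℝ≥0∞) * ∫⁻ t in Ioo 0 T, ∫⁻ x, ‖b t x‖ₑ * ‖u t x‖ₑ := by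
      rw [← lintegral_const_mul' _ _ (by simp)]
      refine lintegral_congr fun t => ?_
      rw [← lintegral_const_mul' _ _ (by simp)]
      refine lintegral_congr fun x => ?_
      rw [enorm_smul]
      simp only [mul_left_comm]
      rfl
    rw [e]
    exact ENNReal.mul_lt_top (by simp) h₁.lintegral_mul_lt_top
  ae_isWeaklyDivFree_carrier := h₁.ae_isWeaklyDivFree_carrier
  ae_isWeaklyDivFree := by
    filter_upwards [h₁.ae_isWeaklyDivFree] with t hd₁
    exact hd₁.const_smul' c
  aestronglyMeasurable_force := h₁.aestronglyMeasurable_force.const_smul c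
  lintegral_force_sq_lt_top := by
    have e : ∫⁻ t in Ioo 0 T, ∫⁻ x, ‖c • g₁ t x‖ₑ ^ 2 =
        (‖c‖₊ : ℝ≥0∞) ^ 2 * ∫⁻ t in Ioo 0 T, ∫⁻ x, ‖g₁ t x‖ₑ ^ 2 := by
      rw [← lintegral_const_mul' _ _ (ENNReal.pow_ne_top ENNReal.coe_ne_top)]
      refine lintegral_congr fun t => ?_
      rw [← lintegral_const_mul' _ _ (ENNReal.pow_ne_top ENNReal.coe_ne_top)]
      refine lintegral_congr fun x => ?_
      rw [enorm_smul, mul_pow]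
      rfl
    rw [e]
    exact ENNReal.mul_lt_top (by simp) h₁.lintegral_force_sq_lt_top
  aestronglyMeasurable_flux j := (h₁.aestronglyMeasurable_flux j).const_smul c
  lintegral_flux_sq_lt_top j := by
    have e : ∫⁻ t in Ioo 0 T, ∫⁻ x, ‖c • F₁ j t x‖ₑ ^ 2 =
        (‖c‖₊ : ℝ≥0∞) ^ 2 * ∫⁻ t in Ioo 0 T, ∫⁻ x, ‖F₁ j t x‖ₑ ^ 2 := by
      rw [← lintegral_const_mul' _ _ (ENNReal.pow_ne_top ENNReal.coe_ne_top)]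
      refine lintegral_congr fun t => ?_
      rw [← lintegral_const_mul' _ _ (ENNReal.pow_ne_top ENNReal.coe_ne_top)]
      refine lintegral_congr fun x => ?_
      rw [enorm_smul, mul_pow]
      rfl
    rw [e]
    exact ENNReal.mul_lt_top (by simp) (h₁.lintegral_flux_sq_lt_top j)
  weak_eq Ψ hΨ hΨdiv := by
    have e₁ := h₁.weak_eq Ψ hΨ hΨdiv
    have hpt : ∀ t x, ⟪c • u t x, FunctionSpaces.Torus.timeDeriv Ψ t x +
          FunctionSpaces.Torus.convect (b t) (Ψ t) x + viscAdj 𝔸 (Ψ t) x⟫_ℝ +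
        A * ⟪b t x, FunctionSpaces.Torus.convect (fun y => c • u t y) (Ψ t) x⟫_ℝ =
        c * (⟪u t x, FunctionSpaces.Torus.timeDeriv Ψ t x +
            FunctionSpaces.Torus.convect (b t) (Ψ t) x + viscAdj 𝔸 (Ψ t) x⟫_ℝ +
          A * ⟪b t x, FunctionSpaces.Torus.convect (u t) (Ψ t) x⟫_ℝ) := by
      intro t x
      simp only [FunctionSpaces.Torus.convect, map_smul, real_inner_smul_left, real_inner_smul_right]
      ring
    have hptF : ∀ t x, ⟪c • g₁ t x, Ψ t x⟫_ℝ -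
          ∑ j, ⟪c • F₁ j t x, FunctionSpaces.Torus.partialDeriv j (Ψ t) x⟫_ℝ =
        c * (⟪g₁ t x, Ψ t x⟫_ℝ - ∑ j, ⟪F₁ j t x, FunctionSpaces.Torus.partialDeriv j (Ψ t) x⟫_ℝ) := by
      intro t x
      simp only [real_inner_smul_left, ← Finset.mul_sum]
      ring
    have hslice : ∀ᵐ t ∂(volume.restrict (Ioo 0 T)),
        ∫ x, (⟪c • u t x, FunctionSpaces.Torus.timeDeriv Ψ t x +
            FunctionSpaces.Torus.convect (b t) (Ψ t) x + viscAdj 𝔸 (Ψ t) x⟫_ℝ +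
          A * ⟪b t x, FunctionSpaces.Torus.convect (fun y => c • u t y) (Ψ t) x⟫_ℝ) =
        c * ∫ x, (⟪u t x, FunctionSpaces.Torus.timeDeriv Ψ t x +
            FunctionSpaces.Torus.convect (b t) (Ψ t) x + viscAdj 𝔸 (Ψ t) x⟫_ℝ +
          A * ⟪b t x, FunctionSpaces.Torus.convect (u t) (Ψ t) x⟫_ℝ) := by
      filter_upwards with t
      rw [← integral_const_mul]
      exact integral_congr_ae (Eventually.of_forall fun x => hpt t x)
    have hsliceF : ∀ᵐ t ∂(volume.restrict (Ioo 0 T)),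
        ∫ x, (⟪c • g₁ t x, Ψ t x⟫_ℝ - ∑ j, ⟪c • F₁ j t x, FunctionSpaces.Torus.partialDeriv j (Ψ t) x⟫_ℝ) =
        c * ∫ x, (⟪g₁ t x, Ψ t x⟫_ℝ - ∑ j, ⟪F₁ j t x, FunctionSpaces.Torus.partialDeriv j (Ψ t) x⟫_ℝ) := by
      filter_upwards with t
      rw [← integral_const_mul]
      exact integral_congr_ae (Eventually.of_forall fun x => hptF t x)
    have hd : ∫ x, ⟪c • u₀ x, Ψ 0 x⟫_ℝ = c * ∫ x, ⟪u₀ x, Ψ 0 x⟫_ℝ := by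
      simp_rw [real_inner_smul_left]
      exact integral_const_mul _ _
    rw [integral_congr_ae hslice, integral_const_mul, integral_congr_ae hsliceF, integral_const_mul, hd,
      ← mul_add, ← mul_add, e₁, mul_zero]

/-- **Negatives of forced weak solutions** are forced weak solutions for the negated forcing and datum.
[cite: Temam1997, Ch. II §3.1–3.2, (3.2)–(3.5), Thm. 3.1] -/
theorem neg (h₁ : IsWeakTensorPassiveVectorForcedOn A T 𝔸 b g₁ F₁ u₀ u) :
    IsWeakTensorPassiveVectorForcedOn A T 𝔸 b (fun t x => -g₁ t x) (fun j t x => -F₁ j t x)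
      (fun x => -u₀ x) (fun t x => -u t x) := by
  have h := h₁.const_smul (-1)
  simp only [neg_smul, one_smul] at h
  exact h

/-- **Differences of forced weak solutions**: `u − v` is a forced weak solution with forcing
`(g₁ − g₂, F₁ − F₂)` from `u₀ − v₀` (integrable data). [cite: Temam1997, Ch. II §3.1–3.2, (3.2)–(3.5), Thm. 3.1] -/
theorem sub (h₁ : IsWeakTensorPassiveVectorForcedOn A T 𝔸 b g₁ F₁ u₀ u)
    (h₂ : IsWeakTensorPassiveVectorForcedOn A T 𝔸 b g₂ F₂ v₀ v)
    (hu₀ : Integrable u₀ volume) (hv₀ : Integrable v₀ volume) :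
    IsWeakTensorPassiveVectorForcedOn A T 𝔸 b (fun t x => g₁ t x - g₂ t x) (fun j t x => F₁ j t x - F₂ j t x)
      (fun x => u₀ x - v₀ x) (fun t x => u t x - v t x) := by
  have h := h₁.add h₂.neg hu₀ hv₀.neg
  simp only [← sub_eq_add_neg] at h
  exact h

/-- **Forced plus unforced**: if `u` is a forced weak solution with forcing `(g, F)` from `u₀` and `v`
an unforced weak solution along the same carrier, coupling and tensor from `v₀` (integrable data), then
`u + v` is a forced weak solution with the SAME forcing from `u₀ + v₀`.
[cite: Temam1997, Ch. II §3.1–3.2, (3.2)–(3.5), Thm. 3.1] -/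
theorem add_unforced (h₁ : IsWeakTensorPassiveVectorForcedOn A T 𝔸 b g₁ F₁ u₀ u)
    (h₂ : IsWeakTensorPassiveVectorOn A T 𝔸 b v₀ v)
    (hu₀ : Integrable u₀ volume) (hv₀ : Integrable v₀ volume) :
    IsWeakTensorPassiveVectorForcedOn A T 𝔸 b g₁ F₁ (fun x => u₀ x + v₀ x) (fun t x => u t x + v t x) := by
  have h := h₁.add h₂.forced_zero hu₀ hv₀
  simp only [add_zero] at h
  exact h

/-- **Forced minus unforced (the difference field of a perturbation argument)**: if `u` is a forced
weak solution with forcing `(g, F)` from `u₀` and `v` an unforced weak solution along the same carrier,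
coupling and tensor from `v₀` (integrable data), then `u − v` is a forced weak solution with the SAME
forcing from `u₀ − v₀` — from the zero datum when `v₀ = u₀`.
[cite: Temam1997, Ch. II §3.1–3.2, (3.2)–(3.5), Thm. 3.1] -/
theorem sub_unforced (h₁ : IsWeakTensorPassiveVectorForcedOn A T 𝔸 b g₁ F₁ u₀ u)
    (h₂ : IsWeakTensorPassiveVectorOn A T 𝔸 b v₀ v)
    (hu₀ : Integrable u₀ volume) (hv₀ : Integrable v₀ volume) :
    IsWeakTensorPassiveVectorForcedOn A T 𝔸 b g₁ F₁ (fun x => u₀ x - v₀ x) (fun t x => u t x - v t x) := by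
  have h := h₁.sub h₂.forced_zero hu₀ hv₀
  simp only [sub_zero] at h
  exact h

end Superposition

end IsWeakTensorPassiveVectorForcedOn

end Torus

end Literature.Analysis.FluidPDE

end
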